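import Summits.NavierStokesRegularity.NavierStokesRegularity.Theorems.LerayQuarterDissipationFiniteDissipationLiouvilleSliceLSix
import Literature.Analysis.FluidPDE.TypeIAncientMildClassical
import Literature.Analysis.FluidPDE.PressureReconstruction
import Literature.Analysis.FluidPDE.TsaiSelfSimilarHolds
import Literature.Analysis.FluidPDE.SverakLandauConformalCalc
import HarnessLib

/-!
# Crux `FiniteDissipationLiouville` (stmt-NavierStokesRegularity-22144), calm-slice leaf, III:
# the unsteadiness against solenoidal tests; an exactly steady slice of a stratum member vanishes

Theorems file of route `LerayQuarterDissipation` (seat ns-lqd-p2 g4; `--supports` the crux; brick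
3/4 of the CALM-SLICE LEAF = the content of `OneCalmSlice`, stmt-NavierStokesRegularity-24375 of
the sister route `CalmSliceGate`). Navier–Stokes regularity is NOT proved here; no summit is.

For a Type-I ancient mild field `w` (KNSS gauge) write `U = w(−1, ·)` and let
`G(y) = ∂ₜw(−1, y) − ½ U(y) − ½ DU(y)[y]` be the UNSTEADINESS vector of the slice `−1`
(`= ∂ₛU` of the similarity profile; Pineau–Vicol 2026, §1.3).

* `integral_inner_unsteadiness_eq` — **the unsteadiness against a solenoidal test is a
  functional of the slice ALONE, with no derivatives on the slice**: for `ψ ∈ C²_c`, `div ψ = 0`,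
  `∫⟪G, ψ⟫ = ∫ (⟪U,(U·∇)ψ⟫ + ⟪U, Δψ⟫ + ⟪U, ψ⟫ + ½⟪U, (y·∇)ψ⟫)`.
  (`w` is classical on `(−2, 0)` for some smooth pressure — `IsTypeIAncientMild.exists_isClassicalNSSolutionOn_Ioo`;
  pair the momentum equation with `ψ` — the pressure drops out and `Δ`, `(U·∇)` move onto `ψ`
  (`IsClassicalNSSolutionOn.integral_inner_timeDerivWithin_test`, Leray 1934 (17)); and
  `∫⟪(y·∇)U, ψ⟫ = −∫⟪U, (y·∇)ψ⟫ − 3∫⟪U, ψ⟫`.)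
* `abs_weakUnsteadiness_le_of_calm` — if the slice is `(δ, R)`-calm (`‖G‖ ≤ δ` on `B(0,R)`) and
  `ψ` is supported in `B(0, R)`, that functional is `≤ δ ∫‖ψ‖` in absolute value.
* `slice_eq_zero_of_weakUnsteadiness_eq_zero` — **an exactly steady slice (in the weak sense) of a
  member of the finite-dissipation stratum vanishes**: if the functional vanishes on all smooth
  compactly supported solenoidal `ψ`, then `G ⊥` solenoidal tests, so `G = ∇π` (de Rham for
  smooth fields + the segment potential, tree `PressureReconstruction`), whence `(U, p(−1) + π)`
  solves LERAY'S PROFILE SYSTEM `−ΔU + ½U + ½(y·∇)U + (U·∇)U + ∇P = 0`, `div U = 0`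
  (`IsLerayProfile 1 (1/2)`) with a `C¹` pressure; `U ∈ L⁶` (`memLp_six_slice`), so Tsai's
  Liouville theorem (`tsai_selfsimilar_holds`, Tsai 1998 Thm 1, `q = 6`) gives `U = 0`.

References: T.-P. Tsai, ARMA 143 (1998) Thm 1; J. Leray, Acta Math. 63 (1934) (17); Galdi,
Lemma III.1.1 (de Rham); Pineau–Vicol, arXiv:2607.09619 §1.3; KNSS, arXiv:0709.3599 §4.
-/

noncomputable section

-- the summit and its single sub-problem share the name (CONVENTIONS §1), as in every Theorems file
set_option linter.dupNamespace false

namespace Summit.NavierStokesRegularity.NavierStokesRegularity.Theorems.FiniteDissipationLiouville.CalmSlice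

open MeasureTheory Set Filter Topology Metric Function TopologicalSpace InnerProductSpace
open Literature.Analysis Literature.Analysis.FluidPDE
open scoped ENNReal NNReal RealInnerProductSpace Laplacian ContDiff

/-! ### Calculus on the slice `−1` of a class member -/

/-- For a class member, `y ↦ ∂ₜw(−1, y)` is the slice at `−1` of the (within-`(−2,0)`) time
derivative, hence smooth; and `∂ₜw(−1,y)` is that within-derivative. [cite: KochNadirashviliSereginSverak2009, Prop. 4.1 (arXiv:0709.3599 p. 8)] -/
theorem deriv_time_eq_timeDerivWithin
    {w : ℝ → EuclideanSpace ℝ (Fin 3) → EuclideanSpace ℝ (Fin 3)}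
    (y : EuclideanSpace ℝ (Fin 3)) :
    deriv (fun τ => w τ y) (-1) = timeDerivWithin (Ioo (-2) 0) w (-1) y := by
  rw [timeDerivWithin_apply, derivWithin_of_isOpen isOpen_Ioo (by norm_num)]

/-- For a class member, `y ↦ ∂ₜw(−1, y)` is smooth (it is a slice of the within-`(−2,0)` time
derivative of the jointly smooth field). [cite: KochNadirashviliSereginSverak2009, Prop. 4.1 (arXiv:0709.3599 p. 8)] -/
theorem contDiff_deriv_time {C : ℝ}
    {w : ℝ → EuclideanSpace ℝ (Fin 3) → EuclideanSpace ℝ (Fin 3)}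
    (hw : IsTypeIAncientMild C w) :
    ContDiff ℝ ∞ fun y => deriv (fun τ => w τ y) (-1) := by
  obtain ⟨p, hcl⟩ := hw.exists_isClassicalNSSolutionOn_Ioo (t₀ := -2) (by norm_num)
  have hm : (-1 : ℝ) ∈ Ioo (-2 : ℝ) 0 := by norm_num
  have h1 : ContDiff ℝ ∞ (timeDerivWithin (Ioo (-2) 0) w (-1)) :=
    (hcl.smooth_velocity.timeDerivWithin (uniqueDiffOn_Ioo _ _)).contDiff_slice hm
  have e : (fun y => deriv (fun τ => w τ y) (-1)) = timeDerivWithin (Ioo (-2) 0) w (-1) :=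
    funext fun y => deriv_time_eq_timeDerivWithin (w := w) y
  rw [e]; exact h1

/-- The unsteadiness vector `y ↦ ∂ₜw(−1,y) − ½ w(−1,y) − ½ Dw(−1)(y)[y]` of a class member is
smooth. [cite: KochNadirashviliSereginSverak2009, Prop. 4.1 (arXiv:0709.3599 p. 8)] -/
theorem contDiff_unsteadiness {C : ℝ}
    {w : ℝ → EuclideanSpace ℝ (Fin 3) → EuclideanSpace ℝ (Fin 3)}
    (hw : IsTypeIAncientMild C w) :
    ContDiff ℝ ∞ fun y => deriv (fun τ => w τ y) (-1) - (1 / 2 : ℝ) • w (-1) y -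
      (1 / 2 : ℝ) • fderiv ℝ (w (-1)) y y := by
  have hU : ContDiff ℝ ∞ (w (-1)) := hw.contDiff_slice (by norm_num)
  have hDU : ContDiff ℝ ∞ (fderiv ℝ (w (-1))) := (contDiff_infty_iff_fderiv.1 hU).2
  have h3 : ContDiff ℝ ∞ fun y => fderiv ℝ (w (-1)) y y := hDU.clm_apply contDiff_id
  exact ((contDiff_deriv_time hw).sub (hU.const_smul (1 / 2 : ℝ))).sub
    (h3.const_smul (1 / 2 : ℝ))

/-! ### The unsteadiness against solenoidal tests -/

/-- **The unsteadiness against a solenoidal test is a derivative-free functional of the slice.**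
For a Type-I ancient mild field `w`, `U = w(−1,·)`, and `ψ ∈ C²_c(ℝ³; ℝ³)` with `div ψ = 0`:
`∫⟪∂ₜw(−1) − ½U − ½(y·∇)U, ψ⟫ = ∫ (⟪U,(U·∇)ψ⟫ + ⟪U,Δψ⟫ + ⟪U,ψ⟫ + ½⟪U,(y·∇)ψ⟫)`
(momentum equation paired with `ψ`: pressure drops out, `Δ` and `(U·∇)` move to `ψ`;
`∫⟪(y·∇)U,ψ⟫ = −∫⟪U,(y·∇)ψ⟫ − 3∫⟪U,ψ⟫`). [cite: Leray1934, (17) p. 206] -/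
theorem integral_inner_unsteadiness_eq {C : ℝ}
    {w : ℝ → EuclideanSpace ℝ (Fin 3) → EuclideanSpace ℝ (Fin 3)}
    (hw : IsTypeIAncientMild C w) {ψ : EuclideanSpace ℝ (Fin 3) → EuclideanSpace ℝ (Fin 3)}
    (hψ : ContDiff ℝ 2 ψ) (hc : HasCompactSupport ψ) (hdiv : VectorCalculus.IsDivFree ψ) :
    ∫ y, ⟪deriv (fun τ => w τ y) (-1) - (1 / 2 : ℝ) • w (-1) y -
        (1 / 2 : ℝ) • fderiv ℝ (w (-1)) y y, ψ y⟫ =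
      ∫ y, (⟪w (-1) y, convect (w (-1)) ψ y⟫ + ⟪w (-1) y, (Δ ψ) y⟫ + ⟪w (-1) y, ψ y⟫ +
        (1 / 2 : ℝ) * ⟪w (-1) y, fderiv ℝ ψ y y⟫) := by
  obtain ⟨p, hcl⟩ := hw.exists_isClassicalNSSolutionOn_Ioo (t₀ := -2) (by norm_num)
  have hm : (-1 : ℝ) ∈ Ioo (-2 : ℝ) 0 := by norm_num
  set U : EuclideanSpace ℝ (Fin 3) → EuclideanSpace ℝ (Fin 3) := w (-1) with hUdef
  -- the momentum equation against `ψ`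
  have key := hcl.integral_inner_timeDerivWithin_test (uniqueDiffOn_Ioo _ _) hm hψ hc hdiv
  have e1 : (fun y => ⟪timeDerivWithin (Ioo (-2) 0) w (-1) y, ψ y⟫) =
      fun y => ⟪deriv (fun τ => w τ y) (-1), ψ y⟫ :=
    funext fun y => by rw [deriv_time_eq_timeDerivWithin (w := w) y]
  rw [e1] at key
  simp only [one_mul, Pi.zero_apply, inner_zero_left, add_zero] at key
  -- regularity and integrability
  have hU : ContDiff ℝ ∞ U := hcl.contDiff_velocity hm
  have hU1 : ContDiff ℝ 1 U := contDiff_infty.1 hU 1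
  have hψ1 : ContDiff ℝ 1 ψ := hψ.of_le one_le_two
  have hUc : Continuous U := hU.continuous
  have hψc : Continuous ψ := hψ.continuous
  have hdtc : Continuous fun y => deriv (fun τ => w τ y) (-1) := (contDiff_deriv_time hw).continuous
  have hDUc : Continuous fun y => fderiv ℝ U y y :=
    (hU1.continuous_fderiv one_ne_zero).clm_apply continuous_id
  have iT : Integrable (fun y => ⟪deriv (fun τ => w τ y) (-1), ψ y⟫) volume :=
    integrable_inner_of_hasCompactSupport_right hdtc hψc hc
  have iU : Integrable (fun y => ⟪U y, ψ y⟫) volume :=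
    integrable_inner_of_hasCompactSupport_right hUc hψc hc
  have iD : Integrable (fun y => ⟪fderiv ℝ U y y, ψ y⟫) volume :=
    integrable_inner_of_hasCompactSupport_right hDUc hψc hc
  have hcD : HasCompactSupport fun y => fderiv ℝ ψ y y :=
    (hc.fderiv (𝕜 := ℝ)).mono fun y hy => by
      contrapose! hy; simp only [mem_support, not_not] at hy; simp [hy]
  have iD' : Integrable (fun y => ⟪U y, fderiv ℝ ψ y y⟫) volume :=
    integrable_inner_of_hasCompactSupport_right hUc
      ((hψ1.continuous_fderiv one_ne_zero).clm_apply continuous_id) hcD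
  -- the dilation term by parts: `∫⟪(y·∇)U,ψ⟫ + ∫⟪U,(y·∇)ψ⟫ + 3∫⟪U,ψ⟫ = 0`
  have hibp := integral_inner_convect_add_eq_zero (u := fun y : EuclideanSpace ℝ (Fin 3) => y)
    (v := U) (w := ψ) contDiff_id hU1 hψ1 hc
  simp only [convect_apply, Sverak2011.divergence_id_three] at hibp
  rw [integral_const_mul] at hibp
  -- the right-hand side, split
  have iC' : Integrable (fun y => ⟪U y, convect U ψ y⟫) volume :=
    integrable_inner_of_hasCompactSupport_right hUc
      ((hψ1.continuous_fderiv one_ne_zero).clm_apply hUc)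
      ((hc.fderiv (𝕜 := ℝ)).mono fun y hy => by
        contrapose! hy; simp only [mem_support, not_not] at hy; simp [convect, hy])
  have iL' : Integrable (fun y => ⟪U y, (Δ ψ) y⟫) volume :=
    integrable_inner_of_hasCompactSupport_right hUc (continuous_laplacian hψ)
      (hc.mono' fun y hy => by
        contrapose! hy; simp [laplacian_eq_zero_of_notMem_tsupport hy])
  have iCL : Integrable (fun y => ⟪U y, convect U ψ y⟫ + ⟪U y, (Δ ψ) y⟫) volume := iC'.add iL'
  have iCLU : Integrable (fun y => ⟪U y, convect U ψ y⟫ + ⟪U y, (Δ ψ) y⟫ + ⟪U y, ψ y⟫) volume :=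
    iCL.add iU
  have iD2 : Integrable (fun y => (1 / 2 : ℝ) * ⟪U y, fderiv ℝ ψ y y⟫) volume := iD'.const_mul _
  have hR : ∫ y, (⟪U y, convect U ψ y⟫ + ⟪U y, (Δ ψ) y⟫ + ⟪U y, ψ y⟫ +
      (1 / 2 : ℝ) * ⟪U y, fderiv ℝ ψ y y⟫) =
      (∫ y, (⟪U y, convect U ψ y⟫ + ⟪U y, (Δ ψ) y⟫)) + (∫ y, ⟪U y, ψ y⟫) +
        (1 / 2 : ℝ) * ∫ y, ⟪U y, fderiv ℝ ψ y y⟫ := by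
    rw [integral_add iCLU iD2, integral_add iCL iU, integral_const_mul]
  -- the left-hand side, split
  have hL : ∫ y, ⟪deriv (fun τ => w τ y) (-1) - (1 / 2 : ℝ) • w (-1) y -
      (1 / 2 : ℝ) • fderiv ℝ (w (-1)) y y, ψ y⟫ =
      (∫ y, ⟪deriv (fun τ => w τ y) (-1), ψ y⟫) - (1 / 2 : ℝ) * (∫ y, ⟪U y, ψ y⟫) -
        (1 / 2 : ℝ) * ∫ y, ⟪fderiv ℝ U y y, ψ y⟫ := by
    have e : ∀ y, ⟪deriv (fun τ => w τ y) (-1) - (1 / 2 : ℝ) • w (-1) y -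
        (1 / 2 : ℝ) • fderiv ℝ (w (-1)) y y, ψ y⟫ =
        ⟪deriv (fun τ => w τ y) (-1), ψ y⟫ - (1 / 2 : ℝ) * ⟪U y, ψ y⟫ -
          (1 / 2 : ℝ) * ⟪fderiv ℝ U y y, ψ y⟫ := fun y => by
      simp only [inner_sub_left, inner_smul_left, RCLike.conj_to_real, hUdef]
    simp_rw [e]
    have iU2 : Integrable (fun y => (1 / 2 : ℝ) * ⟪U y, ψ y⟫) volume := iU.const_mul _
    have iDU2 : Integrable (fun y => (1 / 2 : ℝ) * ⟪fderiv ℝ U y y, ψ y⟫) volume := iD.const_mul _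
    have iTU : Integrable (fun y => ⟪deriv (fun τ => w τ y) (-1), ψ y⟫ - (1 / 2 : ℝ) * ⟪U y, ψ y⟫)
        volume := iT.sub iU2
    rw [integral_sub iTU iDU2, integral_sub iT iU2, integral_const_mul, integral_const_mul]
  rw [hL, hR, key]
  linarith

/-- **Calm slices have small weak unsteadiness.** If the unsteadiness of the slice `−1` is `≤ δ`
on `B(0, R)` and `ψ` is supported in `B(0, R)`, then
`|∫ (⟪U,(U·∇)ψ⟫ + ⟪U,Δψ⟫ + ⟪U,ψ⟫ + ½⟪U,(y·∇)ψ⟫)| ≤ δ ∫‖ψ‖`. [cite: Leray1934, (17) p. 206] -/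
theorem abs_weakUnsteadiness_le_of_calm {C : ℝ}
    {w : ℝ → EuclideanSpace ℝ (Fin 3) → EuclideanSpace ℝ (Fin 3)}
    (hw : IsTypeIAncientMild C w) {δ R : ℝ}
    (hcalm : ∀ y ∈ ball (0 : EuclideanSpace ℝ (Fin 3)) R,
      ‖deriv (fun τ => w τ y) (-1) - (1 / 2 : ℝ) • w (-1) y -
        (1 / 2 : ℝ) • fderiv ℝ (w (-1)) y y‖ ≤ δ)
    {ψ : EuclideanSpace ℝ (Fin 3) → EuclideanSpace ℝ (Fin 3)}
    (hψ : ContDiff ℝ 2 ψ) (hc : HasCompactSupport ψ) (hdiv : VectorCalculus.IsDivFree ψ)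
    (hsupp : tsupport ψ ⊆ ball (0 : EuclideanSpace ℝ (Fin 3)) R) :
    |∫ y, (⟪w (-1) y, convect (w (-1)) ψ y⟫ + ⟪w (-1) y, (Δ ψ) y⟫ + ⟪w (-1) y, ψ y⟫ +
        (1 / 2 : ℝ) * ⟪w (-1) y, fderiv ℝ ψ y y⟫)| ≤ δ * ∫ y, ‖ψ y‖ := by
  rw [← integral_inner_unsteadiness_eq hw hψ hc hdiv, ← Real.norm_eq_abs, ← integral_const_mul]
  refine norm_integral_le_of_norm_le ((hψ.continuous.norm.integrable_of_hasCompactSupport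
    hc.norm).const_mul δ) (Eventually.of_forall fun y => ?_)
  by_cases hy : y ∈ ball (0 : EuclideanSpace ℝ (Fin 3)) R
  · exact (norm_inner_le_norm _ _).trans (mul_le_mul_of_nonneg_right (hcalm y hy) (norm_nonneg _))
  · have h0 : ψ y = 0 := image_eq_zero_of_notMem_tsupport fun h => hy (hsupp h)
    simp [h0]

/-! ### An exactly steady slice of a stratum member vanishes -/

/-- **An exactly steady slice (in the weak sense) of a member of the finite-dissipation stratum
vanishes.** Let `w` be Type-I ancient mild (constant `C`) with the dissipation law
`∫‖∇w(s)‖² ≤ K/√(−s)`, and suppose the weak unsteadiness functional of the slice `U = w(−1,·)`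
vanishes on every smooth compactly supported solenoidal `ψ`. Then `U = 0`: the unsteadiness
vector `G` is orthogonal to solenoidal tests, hence a `C¹` gradient `∇π` (de Rham), so
`(U, p(−1) + π)` solves Leray's profile system with `a = ½`, `ν = 1` (`IsLerayProfile`), and
`U ∈ L⁶` (`memLp_six_slice`) — Tsai's theorem (`tsai_selfsimilar_holds`, `q = 6`). [cite: Tsai1998, Theorem 1 (p. 31)] -/
theorem slice_eq_zero_of_weakUnsteadiness_eq_zero {C K : ℝ}
    {w : ℝ → EuclideanSpace ℝ (Fin 3) → EuclideanSpace ℝ (Fin 3)}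
    (hw : IsTypeIAncientMild C w)
    (hlaw : ∀ s : ℝ, s < 0 → ∫⁻ x, ‖fderiv ℝ (w s) x‖ₑ ^ 2 ≤ ENNReal.ofReal (K / Real.sqrt (-s)))
    (hweak : ∀ ψ : EuclideanSpace ℝ (Fin 3) → EuclideanSpace ℝ (Fin 3), ContDiff ℝ ∞ ψ →
      HasCompactSupport ψ → VectorCalculus.IsDivFree ψ →
      ∫ y, (⟪w (-1) y, convect (w (-1)) ψ y⟫ + ⟪w (-1) y, (Δ ψ) y⟫ + ⟪w (-1) y, ψ y⟫ +
        (1 / 2 : ℝ) * ⟪w (-1) y, fderiv ℝ ψ y y⟫) = 0) :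
    ∀ x, w (-1) x = 0 := by
  obtain ⟨p, hcl⟩ := hw.exists_isClassicalNSSolutionOn_Ioo (t₀ := -2) (by norm_num)
  have hm : (-1 : ℝ) ∈ Ioo (-2 : ℝ) 0 := by norm_num
  set U : EuclideanSpace ℝ (Fin 3) → EuclideanSpace ℝ (Fin 3) := w (-1) with hUdef
  -- the unsteadiness vector and its orthogonality to solenoidal tests
  set G : EuclideanSpace ℝ (Fin 3) → EuclideanSpace ℝ (Fin 3) := fun y =>
    deriv (fun τ => w τ y) (-1) - (1 / 2 : ℝ) • w (-1) y - (1 / 2 : ℝ) • fderiv ℝ (w (-1)) y y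
    with hGdef
  have hG : ContDiff ℝ ∞ G := contDiff_unsteadiness hw
  have horth : ∀ φ : EuclideanSpace ℝ (Fin 3) → EuclideanSpace ℝ (Fin 3),
      FunctionSpaces.IsTestFunctionOn (⊤ : Opens (EuclideanSpace ℝ (Fin 3))) φ →
      VectorCalculus.IsDivFree φ → ∫ y, ⟪G y, φ y⟫ = 0 := by
    intro φ hφ hφdiv
    rw [hGdef]
    rw [integral_inner_unsteadiness_eq hw (contDiff_infty.1 hφ.contDiff 2)
      hφ.hasCompactSupport hφdiv]
    exact hweak φ hφ.contDiff hφ.hasCompactSupport hφdiv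
  -- de Rham: `G = ∇π`
  have hsymm := inner_fderiv_comm_of_forall_integral_inner_eq_zero hG horth
  set π : EuclideanSpace ℝ (Fin 3) → ℝ := fun y => ∫ σ in (0 : ℝ)..1, ⟪G (σ • y), y⟫ with hπdef
  have hπ : ∀ y, HasGradientAt π (G y) y := fun y => hasGradientAt_segmentIntegral hG hsymm y
  have hπF : ∀ y, HasFDerivAt π (toDual ℝ (EuclideanSpace ℝ (Fin 3)) (G y)) y := fun y =>
    (hπ y).hasFDerivAt
  have hπd : Differentiable ℝ π := fun y => (hπF y).differentiableAt
  have hπ1 : ContDiff ℝ 1 π := by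
    rw [contDiff_one_iff_fderiv]
    refine ⟨hπd, ?_⟩
    have e : fderiv ℝ π = fun y => toDual ℝ (EuclideanSpace ℝ (Fin 3)) (G y) :=
      funext fun y => (hπF y).fderiv
    rw [e]
    exact (toDual ℝ (EuclideanSpace ℝ (Fin 3))).continuous.comp hG.continuous
  -- the Leray profile system for `(U, p(-1) + π)`
  have hU : ContDiff ℝ ∞ U := hcl.contDiff_velocity hm
  have hp : ContDiff ℝ ∞ (p (-1)) := hcl.contDiff_pressure hm
  have hp1 : ContDiff ℝ 1 (p (-1)) := contDiff_infty.1 hp 1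
  have hgradP : ∀ y, gradient (fun z => p (-1) z + π z) y = gradient (p (-1)) y + G y := by
    intro y
    have h1 : HasFDerivAt (p (-1))
        (toDual ℝ (EuclideanSpace ℝ (Fin 3)) (gradient (p (-1)) y)) y :=
      ((hp1.differentiable one_ne_zero) y).hasGradientAt.hasFDerivAt
    have h2 : HasGradientAt (fun z => p (-1) z + π z) (gradient (p (-1)) y + G y) y := by
      rw [hasGradientAt_iff_hasFDerivAt, map_add]
      exact h1.add (hπF y)
    exact h2.gradient
  have hmom : ∀ y, deriv (fun τ => w τ y) (-1) + convect U U y =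
      (1 : ℝ) • (Δ U) y - gradient (p (-1)) y := by
    intro y
    have := hcl.momentum (-1) hm y
    rw [← deriv_time_eq_timeDerivWithin (w := w) y] at this
    simpa only [Pi.zero_apply, add_zero] using this
  have hprof : IsLerayProfile 1 (1 / 2 : ℝ) U (fun z => p (-1) z + π z) := by
    refine ⟨contDiff_infty.1 hU 2, hp1.add hπ1, fun y => ?_, hw.isDivFree (by norm_num)⟩
    rw [hgradP y]
    have hGy : G y = deriv (fun τ => w τ y) (-1) - (1 / 2 : ℝ) • U y -
        (1 / 2 : ℝ) • fderiv ℝ U y y := rfl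
    rw [hGy]
    have := hmom y
    rw [one_smul] at this ⊢
    rw [← sub_eq_zero] at this
    rw [← this]
    abel
  -- `U ∈ L⁶` and Tsai's Liouville theorem
  obtain ⟨CL, -, hL6⟩ := Birth.memLp_six_slice
  have hU6 : MemLp U 6 volume := (hL6 C K w hw hlaw (-1) (by norm_num)).1
  have hzero : U = 0 := tsai_selfsimilar_holds one_pos (by norm_num) hprof (q := 6)
    (by norm_num) (by simp) hU6
  intro x
  simpa [hUdef] using congrFun hzero x

end Summit.NavierStokesRegularity.NavierStokesRegularity.Theorems.FiniteDissipationLiouville.CalmSlice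

end
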